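import Literature.Computation.Certificates.ProjectionEigenvalueCertificate
import Literature.Analysis.OperatorTheory.SchurComplementCount
import HarnessLib

/-!
# Projection-error eigenvalue certificate — the end-to-end chain (certified inertia ⇒ `λ_{m+1} ≥ lo`)

Topic `Literature/Computation/Certificates`; SIBLING of `ProjectionEigenvalueCertificate.lean` (the record
`ProjectionLowerCert ⟨s, c2, lo⟩`, its `check`, endpoint rule and `sound`/`sound_card` over X. Liu,
*A framework of verified eigenvalue bounds for self-adjoint differential operators*, Appl. Math. Comput. 267
(2015) [Liu2015] Thm 2.1, proved in `Analysis/OperatorTheory/ProjectionLowerBound.lean`).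

What is composed here, with NOTHING new assumed: the discrete side of `sound_card` made concrete the way a
finite-element certificate record presents it — a basis family `ψ_1..ψ_n` of the discrete space with the
Gram matrices `K = (a'(ψ_i,ψ_j))`, `M = (b'(ψ_i,ψ_j))` of the COMPARISON forms actually assembled; the
projection `Π` represented in that family through a coefficient map (`Πφ = Σ_i coeff(Πφ)_i ψ_i`; for
Crouzeix–Raviart `coeff` = the edge means); and, as the CERTIFIED MATRIX FACT, an INERTIA COUNT:

* `card_lt_le_of_inertia` (EXACT leg): the real symmetric `K − s₀M` has at most `m` negative eigenvalues
  (Mathlib's spectral list `IsHermitian.eigenvalues`; discharged from an exact `LDLᵀ` by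
  `Literature.LinearAlgebra.Matrix.card_eigenvalues_lt_eq_card_neg_pivots`, or from a pinned Schur split
  via `SchurComplementCount`), `M ⪰ 0`, and the record's cut `s ≤ s₀`;
* `card_lt_le_of_inertia_slack` (FLOATING-POINT leg with Weyl slack): the shifted standard matrix
  `K − s₀M + τ·1` has at most `m` negative eigenvalues (`τ ≥ 0` = the slack a float kernel certifies), a
  mass lower bound `μ·(yᵀy) ≤ yᵀMy` with `μ > 0` (diagonal CR mass: `mu_dotProduct_le_diagonal_mulVec`;
  general: `mu_dotProduct_le_of_posSemidef_sub`), and `s ≤ s₀ − τ/μ`.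

In both, for every exact `b`-orthonormal, `a`-diagonal family `u` on whose span `Π` is `a'`-orthogonal with
error constant `C2 ≤ c2`, the number of levels `< lo` is at most `m`. Chain:
`SchurComplementCount.exists_constraints_nonneg_of_inertia_le` (count ⇒ `m` constraint vectors `q_j` with
`yᵀHy ≥ 0` past them) → `constrained_nonneg_of_slack` / `constrained_nonneg_mono` (to the record's level
`s`) → `ProjectionLowerBound.hcoer_of_matrices` (matrix form ⇒ `hcoer` with the functionals
`ℓ_j = q_j ⬝ coeff(·)`) → `ProjectionLowerCert.sound_card`.

HYPOTHESES A CLIENT STILL SUPPLIES: the comparison inequalities `a' ≤ a`, `b ≤ b'`; the exact eigenfamily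
(spectral theorem — operator-free counting form, as the companions); `horth`/`happrox` on `span u` (for FEM
via the assembly lemmas of the sibling file and the PRINTED element constant, e.g. `0.1893 h_K`, which is NOT
certified here); that `K, M` ARE the Gram matrices of the assembled forms (exact rational assembly). WHAT THIS
IS NOT: not a certificate reader (the inertia count is a hypothesis about Mathlib's eigenvalue list, to be
discharged by the typed `LDLᵀ`/Sylvester statements); not any client's number. [cite: Liu2015, Thm 2.1]
-/

namespace Literature.Computation.Certificates.ProjectionLowerCert

open scoped BigOperators
open Finset Matrix

/-- **End-to-end soundness, EXACT inertia leg.** Setting of `sound_card` with the discrete side made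
concrete: `ψ_1..ψ_n` a basis family of the discrete space with Gram matrices `K = (a'(ψ_i,ψ_j))`,
`M = (b'(ψ_i,ψ_j))` of the comparison forms; the projection `Π` represented in that family through a
coefficient map (`Πφ = Σ_i coeff(Πφ)_i ψ_i`); the CERTIFIED MATRIX FACT is an inertia count — the real
symmetric matrix `K − s₀M` has at most `m` negative eigenvalues (Mathlib's spectral list; discharged from an
exact `LDLᵀ` by `Literature.LinearAlgebra.Matrix.card_eigenvalues_lt_eq_card_neg_pivots`, or from a pinned
Schur split) — together with `M ⪰ 0` and a record `⟨s, c2, lo⟩` that passes `check` with `s ≤ s₀`. Then for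
every exact `b`-orthonormal `a`-diagonal family on whose span `Π` is `a'`-orthogonal with error constant
`C2 ≤ c2`, at most `m` levels lie below `lo` (`λ_{m+1} ≥ lo`). Composition of
`SchurComplementCount.exists_constraints_nonneg_of_inertia_le`, `constrained_nonneg_mono`,
`ProjectionLowerBound.hcoer_of_matrices` and `sound_card`; nothing new is assumed.
[cite: Liu2015, Thm 2.1 eq. (6) p. 3 with §3.1 (13)–(14) p. 5 (certificate chain, exact discrete count)] -/
theorem card_lt_le_of_inertia (c : ProjectionLowerCert) (hc : c.check = true)
    {V : Type*} [AddCommGroup V] [Module ℝ V]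
    (a b a' b' : LinearMap.BilinForm ℝ V)
    (ha'_symm : ∀ x y, a' x y = a' y x) (hb'_symm : ∀ x y, b' x y = b' y x)
    (ha'_nonneg : ∀ x, 0 ≤ a' x x) (hb'_nonneg : ∀ x, 0 ≤ b' x x)
    (ha'_le : ∀ x, a' x x ≤ a x x) (hb_le : ∀ x, b x x ≤ b' x x)
    {n : ℕ} (ψ : Fin n → V) (K M : Matrix (Fin n) (Fin n) ℝ)
    (hK : ∀ i j, K i j = a' (ψ i) (ψ j)) (hM : ∀ i j, M i j = b' (ψ i) (ψ j))
    (proj : V →ₗ[ℝ] V) (coeff : V →ₗ[ℝ] (Fin n → ℝ))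
    (hrep : ∀ φ, proj φ = ∑ i, coeff (proj φ) i • ψ i)
    {s₀ : ℝ} (hH : (K - s₀ • M).IsHermitian) {m : ℕ}
    (hcount : Fintype.card {i : Fin n // hH.eigenvalues i < 0} ≤ m)
    (hMpsd : ∀ y : Fin n → ℝ, 0 ≤ y ⬝ᵥ (M *ᵥ y)) (hs : (c.s : ℝ) ≤ s₀)
    {k : ℕ} (u : Fin k → V) (lam : Fin k → ℝ) {C2 : ℝ}
    (hb_on : ∀ i j, b (u i) (u j) = if i = j then 1 else 0)
    (ha_on : ∀ i j, a (u i) (u j) = if i = j then lam i else 0)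
    (hC2 : C2 ≤ c.c2)
    (horth : ∀ φ ∈ Submodule.span ℝ (Set.range u), a' (proj φ) (φ - proj φ) = 0)
    (happrox : ∀ φ ∈ Submodule.span ℝ (Set.range u),
      b' (φ - proj φ) (φ - proj φ) ≤ C2 * a' (φ - proj φ) (φ - proj φ)) :
    Fintype.card {i : Fin k // lam i < (c.lo : ℝ)} ≤ m := by
  classical
  obtain ⟨q, hq⟩ :=
    Literature.Analysis.OperatorTheory.exists_constraints_nonneg_of_inertia_le hH hcount
  have hpos : ∀ y : Fin n → ℝ, (∀ j, q j ⬝ᵥ y = 0) → 0 ≤ y ⬝ᵥ ((K - (c.s : ℝ) • M) *ᵥ y) :=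
    constrained_nonneg_mono K M q hs hMpsd hq
  -- the constraint functionals `ℓ_j = q_j ⬝ coeff(·)` (constraint vectors read through the coefficient map)
  let ℓ : Fin m → V →ₗ[ℝ] ℝ := fun j =>
    { toFun := fun v => q j ⬝ᵥ coeff v
      map_add' := fun x y => by rw [map_add, dotProduct_add]
      map_smul' := fun r x => by rw [map_smul, dotProduct_smul]; rfl }
  refine sound_card c hc a b a' b' ha'_symm hb'_symm ha'_nonneg hb'_nonneg ha'_le hb_le u lam hb_on ha_on
    hC2 proj ℓ horth happrox ?_
  intro φ _ hℓ
  have hy : ∀ j, q j ⬝ᵥ coeff (proj φ) = 0 := fun j => hℓ j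
  have h := Literature.Analysis.OperatorTheory.hcoer_of_matrices a' b' ha'_symm hb'_symm ψ K M hK hM q
    hpos (coeff (proj φ)) hy
  rw [← hrep] at h
  exact h

/-- **End-to-end soundness, FLOATING-POINT leg with Weyl slack.** As `card_lt_le_of_inertia`, but the
certified matrix fact is the inertia of the SHIFTED STANDARD matrix `K − s₀M + τ·1` (at most `m` negative
eigenvalues; `τ ≥ 0` the slack a floating-point kernel certifies, e.g. a smallest-eigenvalue lower bound
`−τ` of `K − s₀M` past the count) together with a mass lower bound `μ·(yᵀy) ≤ yᵀMy`, `μ > 0`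
(`mu_dotProduct_le_diagonal_mulVec` / `mu_dotProduct_le_of_posSemidef_sub`), and the record's cut satisfies
`s ≤ s₀ − τ/μ` (`constrained_nonneg_of_slack`). Conclusion unchanged: at most `m` levels below `lo`.
[cite: Liu2015, Thm 2.1 eq. (6) p. 3 with §3.1 (13)–(14) p. 5 (certificate chain, count with slack)] -/
theorem card_lt_le_of_inertia_slack (c : ProjectionLowerCert) (hc : c.check = true)
    {V : Type*} [AddCommGroup V] [Module ℝ V]
    (a b a' b' : LinearMap.BilinForm ℝ V)
    (ha'_symm : ∀ x y, a' x y = a' y x) (hb'_symm : ∀ x y, b' x y = b' y x)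
    (ha'_nonneg : ∀ x, 0 ≤ a' x x) (hb'_nonneg : ∀ x, 0 ≤ b' x x)
    (ha'_le : ∀ x, a' x x ≤ a x x) (hb_le : ∀ x, b x x ≤ b' x x)
    {n : ℕ} (ψ : Fin n → V) (K M : Matrix (Fin n) (Fin n) ℝ)
    (hK : ∀ i j, K i j = a' (ψ i) (ψ j)) (hM : ∀ i j, M i j = b' (ψ i) (ψ j))
    (proj : V →ₗ[ℝ] V) (coeff : V →ₗ[ℝ] (Fin n → ℝ))
    (hrep : ∀ φ, proj φ = ∑ i, coeff (proj φ) i • ψ i)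
    {s₀ τ μ : ℝ} (hτ : 0 ≤ τ) (hμ : 0 < μ)
    (hH : (K - s₀ • M + τ • (1 : Matrix (Fin n) (Fin n) ℝ)).IsHermitian) {m : ℕ}
    (hcount : Fintype.card {i : Fin n // hH.eigenvalues i < 0} ≤ m)
    (hmass : ∀ y : Fin n → ℝ, μ * (y ⬝ᵥ y) ≤ y ⬝ᵥ (M *ᵥ y)) (hs : (c.s : ℝ) ≤ s₀ - τ / μ)
    {k : ℕ} (u : Fin k → V) (lam : Fin k → ℝ) {C2 : ℝ}
    (hb_on : ∀ i j, b (u i) (u j) = if i = j then 1 else 0)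
    (ha_on : ∀ i j, a (u i) (u j) = if i = j then lam i else 0)
    (hC2 : C2 ≤ c.c2)
    (horth : ∀ φ ∈ Submodule.span ℝ (Set.range u), a' (proj φ) (φ - proj φ) = 0)
    (happrox : ∀ φ ∈ Submodule.span ℝ (Set.range u),
      b' (φ - proj φ) (φ - proj φ) ≤ C2 * a' (φ - proj φ) (φ - proj φ)) :
    Fintype.card {i : Fin k // lam i < (c.lo : ℝ)} ≤ m := by
  classical
  obtain ⟨q, hq⟩ :=
    Literature.Analysis.OperatorTheory.exists_constraints_nonneg_of_inertia_le hH hcount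
  have hslack := constrained_nonneg_of_slack K M q hμ hτ hmass hq
  have hMpsd : ∀ y : Fin n → ℝ, 0 ≤ y ⬝ᵥ (M *ᵥ y) := fun y =>
    (mul_nonneg hμ.le (by simpa [dotProduct] using Finset.sum_nonneg fun i _ => mul_self_nonneg (y i))).trans
      (hmass y)
  have hpos : ∀ y : Fin n → ℝ, (∀ j, q j ⬝ᵥ y = 0) → 0 ≤ y ⬝ᵥ ((K - (c.s : ℝ) • M) *ᵥ y) :=
    constrained_nonneg_mono K M q hs hMpsd hslack
  -- the constraint functionals `ℓ_j = q_j ⬝ coeff(·)` (constraint vectors read through the coefficient map)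
  let ℓ : Fin m → V →ₗ[ℝ] ℝ := fun j =>
    { toFun := fun v => q j ⬝ᵥ coeff v
      map_add' := fun x y => by rw [map_add, dotProduct_add]
      map_smul' := fun r x => by rw [map_smul, dotProduct_smul]; rfl }
  refine sound_card c hc a b a' b' ha'_symm hb'_symm ha'_nonneg hb'_nonneg ha'_le hb_le u lam hb_on ha_on
    hC2 proj ℓ horth happrox ?_
  intro φ _ hℓ
  have hy : ∀ j, q j ⬝ᵥ coeff (proj φ) = 0 := fun j => hℓ j
  have h := Literature.Analysis.OperatorTheory.hcoer_of_matrices a' b' ha'_symm hb'_symm ψ K M hK hM q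
    hpos (coeff (proj φ)) hy
  rw [← hrep] at h
  exact h

end Literature.Computation.Certificates.ProjectionLowerCert
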